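import Summits.QuantumFields.BalabanUV.Beta.GAN24.ValueReadoutLipschitz
import Summits.QuantumFields.BalabanUV.Beta.GAN24.WSlotCauchyThree
import Summits.QuantumFields.BalabanUV.Beta.GAN24.T2SlotOfHW

/-!
# `BalabanUV.Beta.GAN24.W3SourceRows` — ROW W3-F4a (`LocStencil₂` half) AND THE SOURCE-DIFFERENCE SOCKET OF ROW W3-F4b of the owner's
# SKELETON-W3 v1.0 §8.3: the SOURCE OF RECORD `b_j` of the normalised `T2Of` recursion (leaf-04's bracket) is `j`-UNIFORMLY `LocStencil₂`
# and its members `k+j`, `k` differ by a `LocStencil₂` family with a GEOMETRIC constant — from the K-slot, «E3Shape» ∧ «E3Drift» and the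
# mixed-table shape ALONE (G-an2-4 formalisation swarm, leaf prover 08, gen 16; journal INTENT «W3-F4A*»; name PROVISIONAL)

NOT IN PRINT; OUR PROOF ATTEMPT (composition of tree theorems).  HONEST FRAMING (cell contract, verbatim): «discharging `BetaPertH` makes
Bałaban's UV stability UNCONDITIONAL — a real constructive-QFT result; it is NOT the continuum limit and NOT the Clay problem.»  HONEST
DEPENDENCY (verbatim): «continuum YM on T⁴ ⇐ BetaPertH ∧ nine spine estimates (0/9 proved); BetaPertH ⇐ (D1) ∧ (D4) ∧ CAP+tail; G-an2-4
gates asym, D1 and NE2/3/4.»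

THE OBJECT.  leaf-04's affine split of leaf-19's normalised recursion (T2-REC) (`T2RecursionAffine.unitS₂_T2Of_succ_affine`; the owner's
«𝒜∕b OF RECORD», CLAIMS l.7669): `T♮_{j+1} = b_j + lin4 (cE₂·Lc^{2(d+1)}) K♮_j Lc T♮_j` with the SOURCE
`b_j := (cE₂·Lc^{2(d+1)}) • mmRead Lc ∘ K3OfK K♮_j Lc S♮_j M♮_j (W2SymOfK K♮_j Lc S♮_j M♮_j 0 M₂♮_j) + cB • mfNeg ∘ vh₂S`
(`K♮∕S♮∕M♮∕M₂♮ = unitK∕unitS∕unitM∕unitM₂ (sfStep Lc j) (smStep d Lc j)` of `KInvStep Lc j`∕`Spure … j`∕`M1 … j`∕`M2Of mixFF j`).  THE ONE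
OBSERVATION of this module: the `T`-free carrier `W2SymOfK K♮_j Lc S♮_j M♮_j 0 M₂♮_j` IS the normalised member `unitW_j (WbalOf d Lc cE cVH cΛ 0 mixFF j)`
of an2's Stage-A family AT THE ZERO BI-STENCIL BINDER (`SecondOrderUnits.unitW_WbalOf` + `unitS₂_zero`), for which «T2Shape» and «T2Drift»
hold with constant `0`; hence leaf-07's CONDITIONAL W-slot theorems `WSlotOfShapes.hW_of_shapes` ∕ `WSlotCauchyOfShapes.hW_hWall_of_shapes` give
the `T`-free carrier's uniform AND Cauchy rows UNCONDITIONALLY, and leaf-19's `T2SlotOfHW.locStencil₂_mmRead_K3OfK_family` ∕ this lineage's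
`ValueReadoutLipschitz.mmRead_K3OfK_cauchy` read them out.
* §0 the zero bi-stencil binder: `unitS₂_zero`, `locStencil₂_zero_table`, `t2Shape_zero`, `t2Drift_zero`, `unitW_WbalOf_zero`.
* §1 **`source_shape_of_shapes`** (ROW W3-F4a, `LocStencil₂` half; generic d): `UnitDecayK` ∧ «E3Shape» ∧ mixFF shape ⟹ `∃ Cb δb, 0 < δb ∧
  ∀ j, LocStencil₂ (b_j) Cb δb`.  The first-moment conjunct of the row waits on the (T-irr) prover's `mom` (RULINGS-14 (R14-3)).
* §2 **`source_cauchy_of_shapes`** (ROW W3-F4b, source-difference socket; generic d): `UnitDecayK` ∧ `CauchyDecayK` ∧ «E3Shape» ∧ «E3Drift»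
  ∧ mixFF shape ⟹ `∃ cb θb δb, 0 ≤ cb ∧ 0 ≤ θb ∧ θb < 1 ∧ 0 < δb ∧ ∀ k j, LocStencil₂ (b_{k+j} − b_k) (cb·θb^k) δb` — the border cancels; ONE
  application of `mmRead_K3OfK_cauchy` per pair at the common rate (no induction, (R12-2)).
* §3 `d = 3`, `Lc ≥ 2`: **`source_shape_three`**, **`source_cauchy_three`** — K-slot by `KSlotAssembly.convCKWall_holds`, «E3Shape» ∧ «E3Drift»
  by `SpureUnitDrift.e3ShapeDrift_three` BY NAME; residual hypotheses = the mixFF shape with ff-support ONLY (ROWS-MIX of §8.3).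
NOT HERE: the forcing's second summand `(𝒜_{m+1} − 𝒜_m)[x_m]` (needs ROW W3-F3a (T-marg) for the `x_m` factor), the `mom` conjuncts, (F2).

HONEST: [folklore] composition; instantiates NO wall binder by itself, asserts nothing about «T2Shape»∕«T2SupRate» (OPEN, NOT IN PRINT),
discharges NOTHING of (hW, hWall); NOT «W-slot closed», NEVER «G-an2-4 closed», NOT (CONV-C); NOT BetaPertH, NOT continuum, NOT Clay.
0 sorry, 0 cite, 0 `def … : Prop`, 0 def.
-/

noncomputable section

open Literature.MathematicalPhysics.QuantumFieldTheory
open Literature.MathematicalPhysics.QuantumFieldTheory.Balaban1983to89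
open Literature.MathematicalPhysics.QuantumFieldTheory.Balaban1983to89.Beta
open B12Sec2to5 (l1 l1_nonneg)
open ExpKernelCalculus (MKer Decays BiLoc VertexFamily VertexFamily₂)
open OneStepResolventKernel (Fib LocStencil decays_mono biLoc_mono)
open OneStepKernelFamily (KInvStep)
open StepJetData (mfNeg)
open AveragingHessianKernels (hessFF ell)
open BalabanStepJets (locStencil_mono vertexFamily₂_mono)
open BalabanStepJetsSucc (mmRead wE e3Of)
open BalabanCompositeJets (LocStencil₂)
open SecondOrderResponse (W2SymOfK W2SymOfK_swap LocStencilFM)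
open BalabanStepW2 (Spure M1 M2Of WbalOf K3OfK locStencil₂_smul' locStencil₂_add' locStencil₂_mfNeg biLoc_le_mono)
open AveragingMixedJetTables (vh₂S vh2Abs)
open Summit.QuantumFields.BalabanUV.Beta.HessKerDressedUnits (unitK unitS unitW)
open Summit.QuantumFields.BalabanUV.Beta.SecondOrderUnits (unitM unitS₂ unitM₂ unitW_WbalOf)
open Summit.QuantumFields.BalabanUV.Beta.GAN24.CombesThomas (sfStep smStep UnitDecayK CauchyDecayK sfStep_ne_zero smStep_ne_zero)
open Summit.QuantumFields.BalabanUV.Beta.GAN24.StencilSlotOfE3 (one_le_of_two_le)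
open Summit.QuantumFields.BalabanUV.Beta.GAN24.StencilSlotOfShapes (locStencil_mono')
open Summit.QuantumFields.BalabanUV.Beta.GAN24.WSlotOfShapes (unitM_M1_eq vertexFamily_smul_hessFF locStencil_unitS_Spure hW_of_shapes)
open Summit.QuantumFields.BalabanUV.Beta.GAN24.SpureUnitDrift (spureDrift_of_shapes e3ShapeDrift_three)
open Summit.QuantumFields.BalabanUV.Beta.GAN24.T2SlotUnits (unitS₂_apply locStencil₂_vh₂S)
open Summit.QuantumFields.BalabanUV.Beta.GAN24.T2SlotOfHW (locStencil₂_mmRead_K3OfK_family)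
open Summit.QuantumFields.BalabanUV.Beta.GAN24.WSlotCauchyOfShapes (locStencil₂_le_mono vertexFamily_zero mul_pow_le_mul_pow hW_hWall_of_shapes)
open Summit.QuantumFields.BalabanUV.Beta.GAN24.KSlotAssembly (convCKWall_holds)
open Summit.QuantumFields.BalabanUV.Beta.GAN24.ValueReadoutLipschitz (lK3 lK3_nonneg mmRead_K3OfK_cauchy)

namespace Summit.QuantumFields.BalabanUV.Beta.GAN24.W3SourceRows

variable {d : ℕ} {Lc : ℕ} [NeZero Lc]

/-! ## §0 The zero bi-stencil binder: «T2Shape» and «T2Drift» of the zero family hold with constant `0` -/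

omit [NeZero Lc] in
/-- [folklore] The normalisation of the zero bi-stencil table is the zero table. -/
theorem unitS₂_zero (sf sm : ℝ) :
    unitS₂ sf sm (0 : Fin (d + 1) → (Fin (d + 1) → ℤ) → Fin (d + 1) → (Fin (d + 1) → ℤ) → MKer (d + 1) (Fib d)) = 0 := by
  funext κ u κ' u' x z a b
  rw [unitS₂_apply]
  simp

omit [NeZero Lc] in
/-- [folklore] The zero bi-stencil family is a `LocStencil₂` family with constant `0` at any rate. -/
theorem locStencil₂_zero_table {δ : ℝ} :
    LocStencil₂ (0 : Fin (d + 1) → (Fin (d + 1) → ℤ) → Fin (d + 1) → (Fin (d + 1) → ℤ) → MKer (d + 1) (Fib d)) 0 δ := by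
  intro κ u κ' u' x z a b
  simp only [Pi.zero_apply, abs_zero]
  positivity

omit [NeZero Lc] in
/-- [folklore] «T2Shape» of the ZERO binder family in any units: constant `0`, any rate. -/
theorem t2Shape_zero (sf sm : ℕ → ℝ) {δ : ℝ} (j : ℕ) :
    LocStencil₂ (unitS₂ (sf j) (sm j)
      ((fun _ => 0 : ℕ → Fin (d + 1) → (Fin (d + 1) → ℤ) → Fin (d + 1) → (Fin (d + 1) → ℤ) → MKer (d + 1) (Fib d)) j)) 0 δ := by
  rw [unitS₂_zero]
  exact locStencil₂_zero_table

omit [NeZero Lc] in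
/-- [folklore] «T2Drift» of the ZERO binder family in any units: constant `0·θ^k`, any rate. -/
theorem t2Drift_zero (sf sm : ℕ → ℝ) {δ θ : ℝ} (k j : ℕ) :
    LocStencil₂ (unitS₂ (sf (k + j)) (sm (k + j))
        ((fun _ => 0 : ℕ → Fin (d + 1) → (Fin (d + 1) → ℤ) → Fin (d + 1) → (Fin (d + 1) → ℤ) → MKer (d + 1) (Fib d)) (k + j)) -
      unitS₂ (sf k) (sm k)
        ((fun _ => 0 : ℕ → Fin (d + 1) → (Fin (d + 1) → ℤ) → Fin (d + 1) → (Fin (d + 1) → ℤ) → MKer (d + 1) (Fib d)) k))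
      (0 * θ ^ k) δ := by
  rw [unitS₂_zero, unitS₂_zero, sub_self, zero_mul]
  exact locStencil₂_zero_table

/-- [folklore] **THE `T`-FREE CARRIER IS an2's NORMALISED MEMBER AT THE ZERO BINDER**: `unitW_j (WbalOf d Lc cE cVH cΛ 0 mixFF j) =
W2SymOfK K♮_j Lc S♮_j M♮_j 0 M₂♮_j` (`SecondOrderUnits.unitW_WbalOf` + `unitS₂_zero`). -/
theorem unitW_WbalOf_zero (cE cVH cΛ : ℝ)
    (mixFF : Fin (d + 1) → (Fin (d + 1) → ℤ) → Fin (d + 1) → (Fin (d + 1) → ℤ) → MKer (d + 1) (Fib d)) (j : ℕ) :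
    unitW (sfStep Lc j) (smStep d Lc j) (WbalOf d Lc cE cVH cΛ (fun _ => 0) mixFF j) =
      W2SymOfK (unitK (sfStep Lc j) (smStep d Lc j) (KInvStep (d := d) Lc j)) Lc
        (unitS (sfStep Lc j) (smStep d Lc j) (Spure d Lc cE cVH cΛ j)) (unitM (sfStep Lc j) (smStep d Lc j) (M1 d Lc cΛ j)) 0
        (unitM₂ (sfStep Lc j) (smStep d Lc j) (M2Of d Lc mixFF j)) := by
  rw [unitW_WbalOf d Lc (sfStep_ne_zero j) (smStep_ne_zero j), unitS₂_zero]

omit [NeZero Lc] in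
/-- [folklore] In a difference of two sources a common border summand cancels and the scalar factors out. -/
theorem smul_add_sub_smul_add (c c' : ℝ) (A A' B : MKer (d + 1) (Fib d)) :
    c • A + c' • B - (c • A' + c' • B) = c • (A - A') := by
  rw [add_sub_add_right_eq_sub, smul_sub]

/-! ## §1 ROW W3-F4a (`LocStencil₂` half): the source of record is `j`-uniformly `LocStencil₂` -/

/-- **ROW W3-F4a (`LocStencil₂` HALF): THE SOURCE OF RECORD IS `j`-UNIFORMLY `LocStencil₂`** [folklore composition; generic d].  From the
K-slot's decay half `UnitDecayK d Lc (sfStep Lc) (smStep d Lc) C δ`, «E3Shape» (leaf-07's byte shape) and the mixed binder table's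
`LocStencilFM Lc mixFF CM₂ δ₄` with field–field support: `∃ Cb δb, 0 < δb ∧ ∀ j, LocStencil₂ (b_j) Cb δb` for leaf-04's bracket `b_j` (module
docstring).  Route: the `T`-free carrier is `unitW_j (WbalOf … 0 mixFF j)` (`unitW_WbalOf_zero`), so leaf-07's `hW_of_shapes` AT THE ZERO
BINDER (`t2Shape_zero`) gives its `j`-uniform `VertexFamily₂`; then leaf-19's `locStencil₂_mmRead_K3OfK_family` at the common rate and the
`j`-free border `locStencil₂_vh₂S` — `T2SlotOfHW.t2Shape_succ_of_hW` with the binder set to zero. -/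
theorem source_shape_of_shapes (hLc : 1 ≤ Lc) {C δ : ℝ} (hK : UnitDecayK d Lc (sfStep Lc) (smStep d Lc) C δ) (hδ : 0 < δ)
    {cE cVH cΛ C₃ δ₃ : ℝ}
    (hE3 : ∀ j : ℕ, LocStencil (unitS (sfStep Lc (j + 1)) (smStep d Lc (j + 1))
      (fun κ u => (cE * wE d Lc (j + 1)) • e3Of d Lc cE cVH cΛ (j + 1) κ u)) C₃ δ₃) (hδ₃ : 0 < δ₃)
    {mixFF : Fin (d + 1) → (Fin (d + 1) → ℤ) → Fin (d + 1) → (Fin (d + 1) → ℤ) → MKer (d + 1) (Fib d)} {CM₂ δ₄ : ℝ}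
    (hmix : LocStencilFM Lc mixFF CM₂ δ₄) (hδ₄ : 0 < δ₄)
    (hfm : ∀ κ u ρ w x z (α μ' : Fin (d + 1)), mixFF κ u ρ w x z (Sum.inl α) (Sum.inr μ') = 0)
    (hm : ∀ κ u ρ w x z (μ' : Fin (d + 1)) (b : Fib d), mixFF κ u ρ w x z (Sum.inr μ') b = 0) (cE₂ cB : ℝ) :
    ∃ Cb δb : ℝ, 0 < δb ∧ ∀ j, LocStencil₂ (fun κ u κ' u' =>
      (cE₂ * (Lc : ℝ) ^ (2 * (d + 1))) •
          mmRead Lc (K3OfK (unitK (sfStep Lc j) (smStep d Lc j) (KInvStep (d := d) Lc j)) Lc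
            (unitS (sfStep Lc j) (smStep d Lc j) (Spure d Lc cE cVH cΛ j)) (unitM (sfStep Lc j) (smStep d Lc j) (M1 d Lc cΛ j))
            (W2SymOfK (unitK (sfStep Lc j) (smStep d Lc j) (KInvStep (d := d) Lc j)) Lc
              (unitS (sfStep Lc j) (smStep d Lc j) (Spure d Lc cE cVH cΛ j)) (unitM (sfStep Lc j) (smStep d Lc j) (M1 d Lc cΛ j)) 0
              (unitM₂ (sfStep Lc j) (smStep d Lc j) (M2Of d Lc mixFF j))) κ u κ' u')
        + cB • mfNeg (vh₂S d Lc κ u κ' u')) Cb δb := by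
  -- the `T`-free carrier's uniform row: leaf-07's `hW_of_shapes` at the zero binder
  obtain ⟨Cw, δW, hδW, hW⟩ := hW_of_shapes (d := d) (Lc := Lc) hLc hK hδ hE3 hδ₃ (T₂ := fun _ => 0) (C₂ := 0) (δ₂ := δ)
    (fun j => t2Shape_zero (sfStep Lc) (smStep d Lc) j) hδ hmix hδ₄ hfm hm
  have hW0 : ∀ j, VertexFamily₂ (W2SymOfK (unitK (sfStep Lc j) (smStep d Lc j) (KInvStep (d := d) Lc j)) Lc
      (unitS (sfStep Lc j) (smStep d Lc j) (Spure d Lc cE cVH cΛ j)) (unitM (sfStep Lc j) (smStep d Lc j) (M1 d Lc cΛ j)) 0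
      (unitM₂ (sfStep Lc j) (smStep d Lc j) (M2Of d Lc mixFF j))) Lc Cw δW := by
    intro j
    have h := hW j
    rwa [unitW_WbalOf_zero] at h
  -- the first tables: leaf-07's uniform shape of the normalised `Spure`
  obtain ⟨Cs, δs, hδs, hS⟩ := locStencil_unitS_Spure (d := d) (Lc := Lc) hLc hE3 hδ₃
  have hC : 0 ≤ C := (hK 0).nonneg (Sum.inl 0)
  have hCs : 0 ≤ Cs := ((hS 0) 0 0).nonneg (Sum.inl 0)
  have hCw : 0 ≤ Cw := ((hW0 0) 0 0 0 0).nonneg (Sum.inl 0)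
  -- the common rate
  set m : ℝ := min (min δ δs) δW with hm_def
  have hm0 : 0 < m := lt_min (lt_min hδ hδs) hδW
  have hmW : m ≤ δW := min_le_right _ _
  have hms : m ≤ δs := (min_le_left _ _).trans (min_le_right _ _)
  have hmK : m ≤ δ := (min_le_left _ _).trans (min_le_left _ _)
  set CM : ℝ := |cΛ| * (2 * (ell (d + 1) Lc : ℝ) ^ 2 * Real.exp (4 * ((d : ℝ) + 1) * Lc * m)) with hCM_def
  have hK' : ∀ j, Decays (unitK (sfStep Lc j) (smStep d Lc j) (KInvStep (d := d) Lc j)) C m :=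
    fun j => decays_mono (hK j) hC le_rfl hmK
  have hS' : ∀ j, LocStencil (unitS (sfStep Lc j) (smStep d Lc j) (Spure d Lc cE cVH cΛ j)) Cs m :=
    fun j => locStencil_mono (hS j) hCs hms
  have hM' : ∀ j, VertexFamily (unitM (sfStep Lc j) (smStep d Lc j) (M1 d Lc cΛ j)) Lc CM m := by
    intro j
    rw [unitM_M1_eq]
    exact vertexFamily_smul_hessFF hLc cΛ hm0.le
  have hW' : ∀ j, VertexFamily₂ (W2SymOfK (unitK (sfStep Lc j) (smStep d Lc j) (KInvStep (d := d) Lc j)) Lc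
      (unitS (sfStep Lc j) (smStep d Lc j) (Spure d Lc cE cVH cΛ j)) (unitM (sfStep Lc j) (smStep d Lc j) (M1 d Lc cΛ j)) 0
      (unitM₂ (sfStep Lc j) (smStep d Lc j) (M2Of d Lc mixFF j))) Lc Cw m :=
    fun j => vertexFamily₂_mono (hW0 j) hCw hmW
  obtain ⟨C', hC', hval⟩ := locStencil₂_mmRead_K3OfK_family (Lc := Lc) hLc hC hm0 hK' hS' hM' hW'
    (fun j μ y ν y' => W2SymOfK_swap _ _ _ _ _ _ μ y ν y')
  have hm128 : (0 : ℝ) ≤ m / 128 := by positivity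
  refine ⟨|cE₂ * (Lc : ℝ) ^ (2 * (d + 1))| * C' +
      |cB| * (vh2Abs (0 : Fin (d + 1) → ℤ) Lc * Real.exp (6 * ((d : ℝ) + 1) * Lc * (m / 128))), m / 128, by positivity, fun j => ?_⟩
  exact locStencil₂_add' (locStencil₂_smul' _ (hval j)) (locStencil₂_smul' cB (locStencil₂_mfNeg (locStencil₂_vh₂S hLc hm128)))

/-! ## §2 ROW W3-F4b, source-difference socket: the members `k+j`, `k` of the source differ geometrically -/

/-- **ROW W3-F4b (SOURCE-DIFFERENCE SOCKET): THE SOURCE OF RECORD IS CAUCHY AT A GEOMETRIC RATE** [folklore composition; generic d].  From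
the K-slot (`UnitDecayK` ∧ `CauchyDecayK`, ratio `θK ∈ [0,1)`), «E3Shape» ∧ «E3Drift» (leaf-07's byte shapes, ratio `θ₃ ∈ (0,1)`) and the mixed
binder table's shape with field–field support:
`∃ cb θb δb, 0 ≤ cb ∧ 0 ≤ θb ∧ θb < 1 ∧ 0 < δb ∧ ∀ k j, LocStencil₂ (b_{k+j} − b_k) (cb·θb^k) δb` for leaf-04's bracket `b` (module docstring).
Route: the `j`-free border `cB • mfNeg ∘ vh₂S` CANCELS; leaf-07's `hW_hWall_of_shapes` AT THE ZERO BINDER (`t2Shape_zero`, `t2Drift_zero`) gives the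
`T`-free carrier's uniform AND Cauchy rows; the S-data by `locStencil_unitS_Spure` ∕ `SpureUnitDrift.spureDrift_of_shapes`, the `j`-free
multiplier slot by `unitM_M1_eq`; then this lineage's `ValueReadoutLipschitz.mmRead_K3OfK_cauchy` ONCE per pair `(k+j, k)` at the common rate
`m` and common ratio `θb = max θK (max θ₃ θW)` — no induction in `j`. -/
theorem source_cauchy_of_shapes (hLc : 1 ≤ Lc) {C δ cK θK : ℝ} (hK : UnitDecayK d Lc (sfStep Lc) (smStep d Lc) C δ)
    (hKall : CauchyDecayK d Lc (sfStep Lc) (smStep d Lc) cK θK δ) (hδ : 0 < δ) (hθK0 : 0 ≤ θK) (hθK1 : θK < 1)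
    {cE cVH cΛ C₃ c₃ θ₃ δ₃ : ℝ}
    (hE3 : ∀ j : ℕ, LocStencil (unitS (sfStep Lc (j + 1)) (smStep d Lc (j + 1))
      (fun κ u => (cE * wE d Lc (j + 1)) • e3Of d Lc cE cVH cΛ (j + 1) κ u)) C₃ δ₃)
    (hE3d : ∀ k j : ℕ, LocStencil (fun κ u =>
        unitS (sfStep Lc (k + j + 1)) (smStep d Lc (k + j + 1))
            (fun κ u => (cE * wE d Lc (k + j + 1)) • e3Of d Lc cE cVH cΛ (k + j + 1) κ u) κ u -
          unitS (sfStep Lc (k + 1)) (smStep d Lc (k + 1))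
            (fun κ u => (cE * wE d Lc (k + 1)) • e3Of d Lc cE cVH cΛ (k + 1) κ u) κ u) (c₃ * θ₃ ^ k) δ₃)
    (hθ₃ : 0 < θ₃) (hθ₃1 : θ₃ < 1) (hδ₃ : 0 < δ₃)
    {mixFF : Fin (d + 1) → (Fin (d + 1) → ℤ) → Fin (d + 1) → (Fin (d + 1) → ℤ) → MKer (d + 1) (Fib d)} {CM₂ δ₄ : ℝ}
    (hmix : LocStencilFM Lc mixFF CM₂ δ₄) (hδ₄ : 0 < δ₄)
    (hfm : ∀ κ u ρ w x z (α μ' : Fin (d + 1)), mixFF κ u ρ w x z (Sum.inl α) (Sum.inr μ') = 0)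
    (hm : ∀ κ u ρ w x z (μ' : Fin (d + 1)) (b : Fib d), mixFF κ u ρ w x z (Sum.inr μ') b = 0) (cE₂ cB : ℝ) :
    ∃ cb θb δb : ℝ, 0 ≤ cb ∧ 0 ≤ θb ∧ θb < 1 ∧ 0 < δb ∧ ∀ k j, LocStencil₂ (fun κ u κ' u' =>
      ((cE₂ * (Lc : ℝ) ^ (2 * (d + 1))) •
          mmRead Lc (K3OfK (unitK (sfStep Lc (k + j)) (smStep d Lc (k + j)) (KInvStep (d := d) Lc (k + j))) Lc
            (unitS (sfStep Lc (k + j)) (smStep d Lc (k + j)) (Spure d Lc cE cVH cΛ (k + j)))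
            (unitM (sfStep Lc (k + j)) (smStep d Lc (k + j)) (M1 d Lc cΛ (k + j)))
            (W2SymOfK (unitK (sfStep Lc (k + j)) (smStep d Lc (k + j)) (KInvStep (d := d) Lc (k + j))) Lc
              (unitS (sfStep Lc (k + j)) (smStep d Lc (k + j)) (Spure d Lc cE cVH cΛ (k + j)))
              (unitM (sfStep Lc (k + j)) (smStep d Lc (k + j)) (M1 d Lc cΛ (k + j))) 0
              (unitM₂ (sfStep Lc (k + j)) (smStep d Lc (k + j)) (M2Of d Lc mixFF (k + j)))) κ u κ' u')
        + cB • mfNeg (vh₂S d Lc κ u κ' u'))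
      - ((cE₂ * (Lc : ℝ) ^ (2 * (d + 1))) •
          mmRead Lc (K3OfK (unitK (sfStep Lc k) (smStep d Lc k) (KInvStep (d := d) Lc k)) Lc
            (unitS (sfStep Lc k) (smStep d Lc k) (Spure d Lc cE cVH cΛ k)) (unitM (sfStep Lc k) (smStep d Lc k) (M1 d Lc cΛ k))
            (W2SymOfK (unitK (sfStep Lc k) (smStep d Lc k) (KInvStep (d := d) Lc k)) Lc
              (unitS (sfStep Lc k) (smStep d Lc k) (Spure d Lc cE cVH cΛ k)) (unitM (sfStep Lc k) (smStep d Lc k) (M1 d Lc cΛ k)) 0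
              (unitM₂ (sfStep Lc k) (smStep d Lc k) (M2Of d Lc mixFF k))) κ u κ' u')
        + cB • mfNeg (vh₂S d Lc κ u κ' u'))) (cb * θb ^ k) δb := by
  -- the S-data: uniform shape and geometric drift of the normalised first field table (leaf-07 ∕ leaf-10)
  obtain ⟨Cs, δs, hδs, hS⟩ := locStencil_unitS_Spure (d := d) (Lc := Lc) hLc hE3 hδ₃
  obtain ⟨cS, δS, hδS, hSd⟩ := spureDrift_of_shapes (d := d) (Lc := Lc) hLc hθ₃ hE3 hE3d hδ₃
  -- the `T`-free carrier's uniform and Cauchy rows: leaf-07's W-slot pair at the zero binder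
  obtain ⟨Cw, cW, θW, δW, hθW0, hθW1, hδW, hW, hWall⟩ :=
    hW_hWall_of_shapes (d := d) (Lc := Lc) hLc hK hKall hδ hθK0 hθK1 hE3 hE3d hθ₃ hθ₃1 hδ₃ (T₂ := fun _ => 0) (C₂ := 0) (c₂ := 0)
      (θ₂ := 0) (δ₂ := δ) (fun j => t2Shape_zero (sfStep Lc) (smStep d Lc) j) (fun k j => t2Drift_zero (sfStep Lc) (smStep d Lc) k j)
      hδ le_rfl zero_lt_one hmix hδ₄ hfm hm
  have hW0 : ∀ j, VertexFamily₂ (W2SymOfK (unitK (sfStep Lc j) (smStep d Lc j) (KInvStep (d := d) Lc j)) Lc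
      (unitS (sfStep Lc j) (smStep d Lc j) (Spure d Lc cE cVH cΛ j)) (unitM (sfStep Lc j) (smStep d Lc j) (M1 d Lc cΛ j)) 0
      (unitM₂ (sfStep Lc j) (smStep d Lc j) (M2Of d Lc mixFF j))) Lc Cw δW := by
    intro j
    have h := hW j
    rwa [unitW_WbalOf_zero] at h
  have hW0c : ∀ k j, VertexFamily₂
      (W2SymOfK (unitK (sfStep Lc (k + j)) (smStep d Lc (k + j)) (KInvStep (d := d) Lc (k + j))) Lc
          (unitS (sfStep Lc (k + j)) (smStep d Lc (k + j)) (Spure d Lc cE cVH cΛ (k + j)))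
          (unitM (sfStep Lc (k + j)) (smStep d Lc (k + j)) (M1 d Lc cΛ (k + j))) 0
          (unitM₂ (sfStep Lc (k + j)) (smStep d Lc (k + j)) (M2Of d Lc mixFF (k + j))) -
        W2SymOfK (unitK (sfStep Lc k) (smStep d Lc k) (KInvStep (d := d) Lc k)) Lc
          (unitS (sfStep Lc k) (smStep d Lc k) (Spure d Lc cE cVH cΛ k)) (unitM (sfStep Lc k) (smStep d Lc k) (M1 d Lc cΛ k)) 0
          (unitM₂ (sfStep Lc k) (smStep d Lc k) (M2Of d Lc mixFF k))) Lc (cW * θW ^ k) δW := by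
    intro k j
    have h := hWall k j
    rwa [unitW_WbalOf_zero, unitW_WbalOf_zero] at h
  -- nonnegativity of the data constants
  have hC : 0 ≤ C := (hK 0).nonneg (Sum.inl 0)
  have hcK : 0 ≤ cK := by have h := (hKall 0 0).nonneg (Sum.inl 0); simpa using h
  have hCs : 0 ≤ Cs := ((hS 0) 0 0).nonneg (Sum.inl 0)
  have hcS : 0 ≤ cS := by have h := ((hSd 0 0) 0 0).nonneg (Sum.inl 0); simpa using h
  have hCw : 0 ≤ Cw := ((hW0 0) 0 0 0 0).nonneg (Sum.inl 0)
  have hcW : 0 ≤ cW := by have h := ((hW0c 0 0) 0 0 0 0).nonneg (Sum.inl 0); simpa using h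
  -- the common ratio and the common rate
  set θb : ℝ := max θK (max θ₃ θW) with hθb_def
  have hθb0 : 0 ≤ θb := hθK0.trans (le_max_left _ _)
  have hθb1 : θb < 1 := max_lt hθK1 (max_lt hθ₃1 hθW1)
  have hKb : θK ≤ θb := le_max_left _ _
  have h3b : θ₃ ≤ θb := (le_max_left _ _).trans (le_max_right _ _)
  have hWb : θW ≤ θb := (le_max_right _ _).trans (le_max_right _ _)
  set m : ℝ := min δ (min δs (min δS δW)) with hm_def
  have hm0 : 0 < m := lt_min hδ (lt_min hδs (lt_min hδS hδW))
  have hmδ : m ≤ δ := min_le_left _ _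
  have hms : m ≤ δs := (min_le_right _ _).trans (min_le_left _ _)
  have hmS : m ≤ δS := (min_le_right _ _).trans ((min_le_right _ _).trans (min_le_left _ _))
  have hmW : m ≤ δW := (min_le_right _ _).trans ((min_le_right _ _).trans (min_le_right _ _))
  -- the data families at the common rate and ratio
  set CM : ℝ := |cΛ| * (2 * (ell (d + 1) Lc : ℝ) ^ 2 * Real.exp (4 * ((d : ℝ) + 1) * Lc * m)) with hCM_def
  have hK1 : ∀ j, Decays (unitK (sfStep Lc j) (smStep d Lc j) (KInvStep (d := d) Lc j)) C m :=
    fun j => decays_mono (hK j) hC le_rfl hmδ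
  have hKc : ∀ k j, Decays (unitK (sfStep Lc (k + j)) (smStep d Lc (k + j)) (KInvStep (d := d) Lc (k + j)) -
      unitK (sfStep Lc k) (smStep d Lc k) (KInvStep (d := d) Lc k)) (cK * θb ^ k) m :=
    fun k j => decays_mono (hKall k j) (by positivity) (mul_pow_le_mul_pow hcK hθK0 hKb k) hmδ
  have hS1 : ∀ j, LocStencil (unitS (sfStep Lc j) (smStep d Lc j) (Spure d Lc cE cVH cΛ j)) Cs m :=
    fun j => locStencil_mono' (hS j) le_rfl hms
  have hSc : ∀ k j, LocStencil (unitS (sfStep Lc (k + j)) (smStep d Lc (k + j)) (Spure d Lc cE cVH cΛ (k + j)) -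
      unitS (sfStep Lc k) (smStep d Lc k) (Spure d Lc cE cVH cΛ k)) (cS * θb ^ k) m :=
    fun k j => locStencil_mono' (hSd k j) (mul_pow_le_mul_pow hcS hθ₃.le h3b k) hmS
  have hM1 : ∀ j, VertexFamily (unitM (sfStep Lc j) (smStep d Lc j) (M1 d Lc cΛ j)) Lc CM m := by
    intro j
    rw [unitM_M1_eq]
    exact vertexFamily_smul_hessFF hLc cΛ hm0.le
  have hMc : ∀ k j, VertexFamily (unitM (sfStep Lc (k + j)) (smStep d Lc (k + j)) (M1 d Lc cΛ (k + j)) -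
      unitM (sfStep Lc k) (smStep d Lc k) (M1 d Lc cΛ k)) Lc (0 * θb ^ k) m := by
    intro k j
    rw [unitM_M1_eq, unitM_M1_eq, sub_self]
    exact vertexFamily_zero (by positivity)
  have hW1 : ∀ j, VertexFamily₂ (W2SymOfK (unitK (sfStep Lc j) (smStep d Lc j) (KInvStep (d := d) Lc j)) Lc
      (unitS (sfStep Lc j) (smStep d Lc j) (Spure d Lc cE cVH cΛ j)) (unitM (sfStep Lc j) (smStep d Lc j) (M1 d Lc cΛ j)) 0
      (unitM₂ (sfStep Lc j) (smStep d Lc j) (M2Of d Lc mixFF j))) Lc Cw m :=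
    fun j => vertexFamily₂_mono (hW0 j) hCw hmW
  have hWc : ∀ k j, VertexFamily₂
      (W2SymOfK (unitK (sfStep Lc (k + j)) (smStep d Lc (k + j)) (KInvStep (d := d) Lc (k + j))) Lc
          (unitS (sfStep Lc (k + j)) (smStep d Lc (k + j)) (Spure d Lc cE cVH cΛ (k + j)))
          (unitM (sfStep Lc (k + j)) (smStep d Lc (k + j)) (M1 d Lc cΛ (k + j))) 0
          (unitM₂ (sfStep Lc (k + j)) (smStep d Lc (k + j)) (M2Of d Lc mixFF (k + j))) -
        W2SymOfK (unitK (sfStep Lc k) (smStep d Lc k) (KInvStep (d := d) Lc k)) Lc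
          (unitS (sfStep Lc k) (smStep d Lc k) (Spure d Lc cE cVH cΛ k)) (unitM (sfStep Lc k) (smStep d Lc k) (M1 d Lc cΛ k)) 0
          (unitM₂ (sfStep Lc k) (smStep d Lc k) (M2Of d Lc mixFF k))) Lc (cW * θb ^ k) m :=
    fun k j μ y ν y' => biLoc_le_mono (hW0c k j μ y ν y') (by positivity) (mul_pow_le_mul_pow hcW hθW0 hWb k) hmW
  have hWs : ∀ (j : ℕ) (μ : Fin (d + 1)) (y : Fin (d + 1) → ℤ) (ν : Fin (d + 1)) (y' : Fin (d + 1) → ℤ),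
      W2SymOfK (unitK (sfStep Lc j) (smStep d Lc j) (KInvStep (d := d) Lc j)) Lc
          (unitS (sfStep Lc j) (smStep d Lc j) (Spure d Lc cE cVH cΛ j)) (unitM (sfStep Lc j) (smStep d Lc j) (M1 d Lc cΛ j)) 0
          (unitM₂ (sfStep Lc j) (smStep d Lc j) (M2Of d Lc mixFF j)) ν y' μ y =
        W2SymOfK (unitK (sfStep Lc j) (smStep d Lc j) (KInvStep (d := d) Lc j)) Lc
          (unitS (sfStep Lc j) (smStep d Lc j) (Spure d Lc cE cVH cΛ j)) (unitM (sfStep Lc j) (smStep d Lc j) (M1 d Lc cΛ j)) 0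
          (unitM₂ (sfStep Lc j) (smStep d Lc j) (M2Of d Lc mixFF j)) μ y ν y' :=
    fun j μ y ν y' => W2SymOfK_swap _ _ _ _ _ _ μ y ν y'
  have hCM : 0 ≤ CM := ((hM1 0) 0 0).nonneg (Sum.inl 0)
  have hL : 0 ≤ lK3 d C Cs CM Cw cK cS 0 cW (m / 4) := lK3_nonneg hC hCs hCM hCw hcK hcS le_rfl hcW (by positivity)
  refine ⟨|cE₂ * (Lc : ℝ) ^ (2 * (d + 1))| * lK3 d C Cs CM Cw cK cS 0 cW (m / 4), θb, m / 128, by positivity, hθb0, hθb1,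
    by positivity, fun k j => ?_⟩
  have key := locStencil₂_smul' (cE₂ * (Lc : ℝ) ^ (2 * (d + 1)))
    (mmRead_K3OfK_cauchy hLc hm0 hK1 hKc hS1 hSc hM1 hMc hW1 hWc hWs k j)
  intro κ u κ' u'
  dsimp only
  rw [smul_add_sub_smul_add, show |cE₂ * (Lc : ℝ) ^ (2 * (d + 1))| * lK3 d C Cs CM Cw cK cS 0 cW (m / 4) * θb ^ k
      = |cE₂ * (Lc : ℝ) ^ (2 * (d + 1))| * (lK3 d C Cs CM Cw cK cS 0 cW (m / 4) * θb ^ k) by ring]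
  exact key κ u κ' u'

/-! ## §3 `d = 3`, `Lc ≥ 2`: the K-slot and the S-slot shapes BY NAME — residual hypotheses = the mixFF shape only -/

/-- **ROW W3-F4a (`LocStencil₂` half) AT `d = 3`, `Lc ≥ 2`, FROM THE MIXED-TABLE SHAPE ALONE** [folklore composition]: K-slot by road P1's
`KSlotAssembly.convCKWall_holds`, «E3Shape» by the S-slot's `SpureUnitDrift.e3ShapeDrift_three`, into `source_shape_of_shapes`. -/
theorem source_shape_three {Lc : ℕ} [NeZero Lc] (hLc : 2 ≤ Lc) (cE cVH cΛ cE₂ cB : ℝ)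
    {mixFF : Fin (3 + 1) → (Fin (3 + 1) → ℤ) → Fin (3 + 1) → (Fin (3 + 1) → ℤ) → MKer (3 + 1) (Fib 3)} {CM₂ δ₄ : ℝ}
    (hmix : LocStencilFM Lc mixFF CM₂ δ₄) (hδ₄ : 0 < δ₄)
    (hfm : ∀ κ u ρ w x z (α μ' : Fin (3 + 1)), mixFF κ u ρ w x z (Sum.inl α) (Sum.inr μ') = 0)
    (hm : ∀ κ u ρ w x z (μ' : Fin (3 + 1)) (b : Fib 3), mixFF κ u ρ w x z (Sum.inr μ') b = 0) :
    ∃ Cb δb : ℝ, 0 < δb ∧ ∀ j, LocStencil₂ (fun κ u κ' u' =>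
      (cE₂ * (Lc : ℝ) ^ (2 * (3 + 1))) •
          mmRead Lc (K3OfK (unitK (sfStep Lc j) (smStep 3 Lc j) (KInvStep (d := 3) Lc j)) Lc
            (unitS (sfStep Lc j) (smStep 3 Lc j) (Spure 3 Lc cE cVH cΛ j)) (unitM (sfStep Lc j) (smStep 3 Lc j) (M1 3 Lc cΛ j))
            (W2SymOfK (unitK (sfStep Lc j) (smStep 3 Lc j) (KInvStep (d := 3) Lc j)) Lc
              (unitS (sfStep Lc j) (smStep 3 Lc j) (Spure 3 Lc cE cVH cΛ j)) (unitM (sfStep Lc j) (smStep 3 Lc j) (M1 3 Lc cΛ j)) 0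
              (unitM₂ (sfStep Lc j) (smStep 3 Lc j) (M2Of 3 Lc mixFF j))) κ u κ' u')
        + cB • mfNeg (vh₂S 3 Lc κ u κ' u')) Cb δb := by
  obtain ⟨C, δ, cK, θ, hδ, -, -, hK, -⟩ := convCKWall_holds (Lc := Lc) hLc
  obtain ⟨C₃, c₃, θ₃, δ₃, -, -, hδ₃, hE3, -⟩ := e3ShapeDrift_three (Lc := Lc) hLc cE cVH cΛ
  exact source_shape_of_shapes (one_le_of_two_le hLc) hK hδ hE3 hδ₃ hmix hδ₄ hfm hm cE₂ cB

/-- **ROW W3-F4b (SOURCE-DIFFERENCE SOCKET) AT `d = 3`, `Lc ≥ 2`, FROM THE MIXED-TABLE SHAPE ALONE** [folklore composition]: K-slot (both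
rows) by `KSlotAssembly.convCKWall_holds`, «E3Shape» ∧ «E3Drift» by `SpureUnitDrift.e3ShapeDrift_three`, into `source_cauchy_of_shapes`. -/
theorem source_cauchy_three {Lc : ℕ} [NeZero Lc] (hLc : 2 ≤ Lc) (cE cVH cΛ cE₂ cB : ℝ)
    {mixFF : Fin (3 + 1) → (Fin (3 + 1) → ℤ) → Fin (3 + 1) → (Fin (3 + 1) → ℤ) → MKer (3 + 1) (Fib 3)} {CM₂ δ₄ : ℝ}
    (hmix : LocStencilFM Lc mixFF CM₂ δ₄) (hδ₄ : 0 < δ₄)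
    (hfm : ∀ κ u ρ w x z (α μ' : Fin (3 + 1)), mixFF κ u ρ w x z (Sum.inl α) (Sum.inr μ') = 0)
    (hm : ∀ κ u ρ w x z (μ' : Fin (3 + 1)) (b : Fib 3), mixFF κ u ρ w x z (Sum.inr μ') b = 0) :
    ∃ cb θb δb : ℝ, 0 ≤ cb ∧ 0 ≤ θb ∧ θb < 1 ∧ 0 < δb ∧ ∀ k j, LocStencil₂ (fun κ u κ' u' =>
      ((cE₂ * (Lc : ℝ) ^ (2 * (3 + 1))) •
          mmRead Lc (K3OfK (unitK (sfStep Lc (k + j)) (smStep 3 Lc (k + j)) (KInvStep (d := 3) Lc (k + j))) Lc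
            (unitS (sfStep Lc (k + j)) (smStep 3 Lc (k + j)) (Spure 3 Lc cE cVH cΛ (k + j)))
            (unitM (sfStep Lc (k + j)) (smStep 3 Lc (k + j)) (M1 3 Lc cΛ (k + j)))
            (W2SymOfK (unitK (sfStep Lc (k + j)) (smStep 3 Lc (k + j)) (KInvStep (d := 3) Lc (k + j))) Lc
              (unitS (sfStep Lc (k + j)) (smStep 3 Lc (k + j)) (Spure 3 Lc cE cVH cΛ (k + j)))
              (unitM (sfStep Lc (k + j)) (smStep 3 Lc (k + j)) (M1 3 Lc cΛ (k + j))) 0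
              (unitM₂ (sfStep Lc (k + j)) (smStep 3 Lc (k + j)) (M2Of 3 Lc mixFF (k + j)))) κ u κ' u')
        + cB • mfNeg (vh₂S 3 Lc κ u κ' u'))
      - ((cE₂ * (Lc : ℝ) ^ (2 * (3 + 1))) •
          mmRead Lc (K3OfK (unitK (sfStep Lc k) (smStep 3 Lc k) (KInvStep (d := 3) Lc k)) Lc
            (unitS (sfStep Lc k) (smStep 3 Lc k) (Spure 3 Lc cE cVH cΛ k)) (unitM (sfStep Lc k) (smStep 3 Lc k) (M1 3 Lc cΛ k))
            (W2SymOfK (unitK (sfStep Lc k) (smStep 3 Lc k) (KInvStep (d := 3) Lc k)) Lc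
              (unitS (sfStep Lc k) (smStep 3 Lc k) (Spure 3 Lc cE cVH cΛ k)) (unitM (sfStep Lc k) (smStep 3 Lc k) (M1 3 Lc cΛ k)) 0
              (unitM₂ (sfStep Lc k) (smStep 3 Lc k) (M2Of 3 Lc mixFF k))) κ u κ' u')
        + cB • mfNeg (vh₂S 3 Lc κ u κ' u'))) (cb * θb ^ k) δb := by
  obtain ⟨C, δ, cK, θ, hδ, hθ0, hθ1, hK, hKall⟩ := convCKWall_holds (Lc := Lc) hLc
  obtain ⟨C₃, c₃, θ₃, δ₃, hθ₃, hθ₃1, hδ₃, hE3, hE3d⟩ := e3ShapeDrift_three (Lc := Lc) hLc cE cVH cΛ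
  exact source_cauchy_of_shapes (one_le_of_two_le hLc) hK hKall hδ hθ0 hθ1 hE3 hE3d hθ₃ hθ₃1 hδ₃ hmix hδ₄ hfm hm cE₂ cB

end Summit.QuantumFields.BalabanUV.Beta.GAN24.W3SourceRows

end
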